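/-
Copyright: cell pub-balaban-gaps (YM BLITZ Y1, track G1), seat g1-p2 GEN 12 (unit `pub-balaban-gaps-g1-p2`).  Row (D4) NODE O,
MECHANISM ∕ OBJECT-on-66's-carrier level — ROAD (c′) of g1-plan-1 GEN 39 ([G1-PLAN1-G39-PRECISION-110], skeleton #26 (T)): the
χ-TRUNCATED bond logarithms `χ(x)·X_ν(u,x)` of a field with 66's two (3.37)-windows `(a₀, a₁)` keep BOTH windows GLOBALLY with
`(a₀, a₁ + c_χa₀)` when `0 ≤ χ ≤ 1` is `ηc_χ`-Lipschitz along bonds, so 66's END applies to the truncated field ON THE WHOLE TORUS: its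
one-scale covariant propagator is a block walk expansion with value and derivative letters free of `K`, the volume and the fibre — the
WHOLE-torus seed `G′(Ũ^□)` of road (c′), with NO sub-domain ∕ Dirichlet propagator.  HONEST FRAMING: `X`, `χ` are data (no cutoff is
constructed here); nothing of Bałaban's `Δ^{(k)}(𝐔)` is constructed; words of row (D4) UNCHANGED (`ExistsUniformAcrossSmall` +
`TermDomination`, OBJECT level); (D4) instance 0∕1; NOT BetaPertH, NOT continuum, NOT Clay.
-/
import Summits.QuantumFields.BalabanUV.Gaps.D4WalkBlockGaugeField
import Summits.QuantumFields.BalabanUV.Gaps.D4WalkBlockExpHolo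

/-!
# `Gaps.D4WalkBlockTruncationWindows` — a unit-scale cutoff keeps the two (3.37)-windows; the truncated gauge field's one-scale
# covariant propagator is a K-uniform block walk expansion on the whole torus (cell pub-balaban-gaps, seat g1-p2 gen 12)

HONEST DEPENDENCY (cell pub-balaban, verbatim): continuum YM on T⁴ ⇐ BetaPertH ∧ nine spine estimates (0/9 proved);
BetaPertH ⇐ (D1) ∧ (D4) ∧ CAP+tail.

[B9] p. 408 l. 1–6: «Applying the gauge transformation u we get U′ = U^u = e^{iηA} with A satisfying the inequalities in (3.35) … This
implies that U′ satisfies (3.37) … with U = 1 and α₁ = O(1)Mα₀ … we can apply the above Corollary [3.5]».  Print then localizes the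
propagators to the Dirichlet sub-domains `□̃` ((3.87) p. 409, p. 394).  ROAD (c′) (g1-plan-1 GEN 39) replaces the sub-domain by a CUTOFF:
`Ũ^□ := e^{χ_□X^{(□)}}` on the whole torus, `χ_□ ≡ 1` near `supp h_□`, `≡ 0` off `□̃`, `|χ_□(x) − χ_□(x − e_ν)| ≤ ηc_χ`.
* §1 `rowSumNorm_smul` ∕ `colSumNorm_smul`, `rowSumNorm_add_le` ∕ `colSumNorm_add_le`, `norm_ofReal_le_one`, `smul_sub_smul_eq`.
* §2 **`truncation_window0`** (the bond window `ηa₀` survives `0 ≤ χ ≤ 1`), **`truncation_window1`** (the derivative window becomes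
  `η²(a₁ + c_χa₀)`: `χ(x)X(x) − χ(x′)X(x′) = χ(x)(X(x) − X(x′)) + (χ(x) − χ(x′))X(x′)`), `truncation_holo` (entrywise holomorphy of
  `e^{±χX}` from that of `X`).
* §3 **`blockWalkExpansion_truncatedGaugeField_oneScaleTorus`** — 66's END `blockWalkExpansion_gaugeField_oneScaleTorus` for the
  truncated field, VERBATIM with `a₁ ↦ a₁ + c_χa₀`: NO constant depends on `K`, the volume, the fibre, or the cutoff beyond `c_χ`.
WHAT IT IS NOT.  The cutoffs `χ_□` and the per-cube (3.35) gauges are not constructed here (107 `D4WalkBlockReg335CubeDictionary` holds the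
gauges); the resummation is `D4WalkBlockSeedResummation`; OBJECT level untouched.

References: T. Bałaban, Comm. Math. Phys. **99** (1985) 389–434 [B9], (3.35)–(3.37) p. 396, Cor. 3.5 p. 407, p. 408, (3.87) p. 409.
-/

noncomputable section

namespace Summit.QuantumFields.BalabanUV.Gaps.D4WalkBlockTruncationWindows

open Metric Set Finset NormedSpace
open scoped Matrix
open Literature.MathematicalPhysics.QuantumFieldTheory.Balaban1983to89
open Literature.MathematicalPhysics.QuantumFieldTheory.Balaban1983to89.B9SectDWalk (DomBy)
open Literature.MathematicalPhysics.QuantumFieldTheory.Balaban1983to89.B9Thm34Ext (toB6)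
open Literature.MathematicalPhysics.QuantumFieldTheory.Balaban1983to89.B9Thm37GlueTorus (torusGeom tdist1)
open Literature.MathematicalPhysics.QuantumFieldTheory.Balaban1983to89.TreeLengthTorus (TPt)
open Literature.MathematicalPhysics.QuantumFieldTheory.Balaban1983to89.B5TorusCover (UT)
open Literature.MathematicalPhysics.QuantumFieldTheory.Balaban1983to89.B11SectG (RowSum)
open Literature.MathematicalPhysics.QuantumFieldTheory.Balaban1983to89.B5Ineq137Torus (Nv)
open Literature.MathematicalPhysics.QuantumFieldTheory.Balaban1983to89.B6Prop22OneScaleTorus (Index)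
open Summit.QuantumFields.BalabanUV.Gaps.D4WalkBlock (blockNorm BlockWalkExpansion)
open Summit.QuantumFields.BalabanUV.Gaps.D4WalkBlockFlatLetters (cubeOf)
open Summit.QuantumFields.BalabanUV.Gaps.D4WalkBlockCovariantShift (covDop covB)
open Summit.QuantumFields.BalabanUV.Gaps.D4WalkBlockTransportAlgebra (rowSumNorm colSumNorm rowSumNorm_nonneg colSumNorm_nonneg)
open Summit.QuantumFields.BalabanUV.Gaps.D4WalkBlockExpHolo (differentiableOn_exp_entry_family differentiableOn_exp_neg_entry_family)
open Summit.QuantumFields.BalabanUV.Gaps.D4WalkBlockCovariantPropagator (covOp)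
open Summit.QuantumFields.BalabanUV.Gaps.D4WalkBlockCovariantBlockAveraging (PU)
open Summit.QuantumFields.BalabanUV.Gaps.D4WalkBlockGaugeField

/-! ## §1. Scalar multiples and sums under the fibre row ∕ column sums -/

section Scalar
variable {N : ℕ}

/-- `rowSumNorm (c•M) = ‖c‖·rowSumNorm M`. ([folklore]) -/
theorem rowSumNorm_smul (c : ℂ) (M : Matrix (Fin N) (Fin N) ℂ) (a : Fin N) : rowSumNorm (c • M) a = ‖c‖ * rowSumNorm M a := by
  unfold rowSumNorm
  rw [Finset.mul_sum]
  exact Finset.sum_congr rfl fun b _ => by rw [Matrix.smul_apply, smul_eq_mul, norm_mul]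

/-- `colSumNorm (c•M) = ‖c‖·colSumNorm M`. ([folklore]) -/
theorem colSumNorm_smul (c : ℂ) (M : Matrix (Fin N) (Fin N) ℂ) (b : Fin N) : colSumNorm (c • M) b = ‖c‖ * colSumNorm M b := by
  unfold colSumNorm
  rw [Finset.mul_sum]
  exact Finset.sum_congr rfl fun d _ => by rw [Matrix.smul_apply, smul_eq_mul, norm_mul]

/-- subadditivity of the fibre row sums. ([folklore]) -/
theorem rowSumNorm_add_le (M M' : Matrix (Fin N) (Fin N) ℂ) (a : Fin N) :
    rowSumNorm (M + M') a ≤ rowSumNorm M a + rowSumNorm M' a := by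
  unfold rowSumNorm
  rw [← Finset.sum_add_distrib]
  exact Finset.sum_le_sum fun b _ => by rw [Matrix.add_apply]; exact norm_add_le _ _

/-- subadditivity of the fibre column sums. ([folklore]) -/
theorem colSumNorm_add_le (M M' : Matrix (Fin N) (Fin N) ℂ) (b : Fin N) :
    colSumNorm (M + M') b ≤ colSumNorm M b + colSumNorm M' b := by
  unfold colSumNorm
  rw [← Finset.sum_add_distrib]
  exact Finset.sum_le_sum fun d _ => by rw [Matrix.add_apply]; exact norm_add_le _ _

/-- a cutoff value `0 ≤ t ≤ 1` has norm `≤ 1` as a complex scalar. ([folklore]) -/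
theorem norm_ofReal_le_one {t : ℝ} (h0 : 0 ≤ t) (h1 : t ≤ 1) : ‖((t : ℝ) : ℂ)‖ ≤ 1 := by
  rw [Complex.norm_real, Real.norm_eq_abs, abs_of_nonneg h0]; exact h1

/-- `c•A − c′•B = c•(A − B) + (c − c′)•B` — the one-line reason the derivative window survives a Lipschitz cutoff. ([folklore]) -/
theorem smul_sub_smul_eq (c c' : ℝ) (A B : Matrix (Fin N) (Fin N) ℂ) :
    ((c : ℝ) : ℂ) • A - ((c' : ℝ) : ℂ) • B = ((c : ℝ) : ℂ) • (A - B) + ((c - c' : ℝ) : ℂ) • B := by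
  rw [smul_sub, Complex.ofReal_sub, sub_smul]; abel

end Scalar

/-! ## §2. The truncation keeps both (3.37)-windows -/

section Truncation
variable (P : Params) (N : ℕ) {E : Type*} [NormedAddCommGroup E] [NormedSpace ℂ E]
variable (Xf : Fin P.d → E → Site P 0 → Matrix (Fin N) (Fin N) ℂ) (χ : Site P 0 → ℝ) {R a₀ a₁ cχ : ℝ}

omit [NormedSpace ℂ E] in
/-- **(T₀) THE BOND WINDOW SURVIVES THE CUTOFF**: rows ∕ columns of `X_ν(u,x) ≤ ηa₀` and `0 ≤ χ ≤ 1` ⟹ the same for `χ(x)·X_ν(u,x)`,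
everywhere. [cite: Balaban1985BackgroundPropagators, (3.37) p.396, p.408] -/
theorem truncation_window0 (hχ : ∀ x, 0 ≤ χ x ∧ χ x ≤ 1)
    (hw0 : ∀ ν, ∀ u ∈ ball (0 : E) R, ∀ x a', rowSumNorm (Xf ν u x) a' ≤ P.eps * a₀ ∧ colSumNorm (Xf ν u x) a' ≤ P.eps * a₀) :
    ∀ ν, ∀ u ∈ ball (0 : E) R, ∀ x a', rowSumNorm ((((χ x : ℝ) : ℂ)) • Xf ν u x) a' ≤ P.eps * a₀ ∧
      colSumNorm ((((χ x : ℝ) : ℂ)) • Xf ν u x) a' ≤ P.eps * a₀ := by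
  intro ν u hu x a'
  have hc : ‖((χ x : ℝ) : ℂ)‖ ≤ 1 := norm_ofReal_le_one (hχ x).1 (hχ x).2
  obtain ⟨hr, hcol⟩ := hw0 ν u hu x a'
  refine ⟨?_, ?_⟩
  · rw [rowSumNorm_smul]; exact (mul_le_of_le_one_left (rowSumNorm_nonneg _ _) hc).trans hr
  · rw [colSumNorm_smul]; exact (mul_le_of_le_one_left (colSumNorm_nonneg _ _) hc).trans hcol

omit [NormedSpace ℂ E] in
/-- **(T₁) THE DERIVATIVE WINDOW AFTER THE CUTOFF IS `η²(a₁ + c_χa₀)`**: `χ(x)X(x) − χ(x − e_ν)X(x − e_ν) = χ(x)(X(x) − X(x − e_ν)) +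
(χ(x) − χ(x − e_ν))X(x − e_ν)`, the first term `≤ 1·η²a₁`, the second `≤ ηc_χ·ηa₀` — print's «α₁ = O(1)Mα₀» with the cutoff's unit-scale
Lipschitz constant in place of `M`. [cite: Balaban1985BackgroundPropagators, (3.35)–(3.37) p.396, p.408] -/
theorem truncation_window1 (hχ : ∀ x, 0 ≤ χ x ∧ χ x ≤ 1) (hLip : ∀ ν x, |χ x - χ (Site.unshift x ν)| ≤ P.eps * cχ)
    (hw0 : ∀ ν, ∀ u ∈ ball (0 : E) R, ∀ x a', rowSumNorm (Xf ν u x) a' ≤ P.eps * a₀ ∧ colSumNorm (Xf ν u x) a' ≤ P.eps * a₀)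
    (hw1 : ∀ ν, ∀ u ∈ ball (0 : E) R, ∀ x a', rowSumNorm (Xf ν u x - Xf ν u (Site.unshift x ν)) a' ≤ P.eps ^ 2 * a₁ ∧
      colSumNorm (Xf ν u x - Xf ν u (Site.unshift x ν)) a' ≤ P.eps ^ 2 * a₁) :
    ∀ ν, ∀ u ∈ ball (0 : E) R, ∀ x a',
      rowSumNorm ((((χ x : ℝ) : ℂ)) • Xf ν u x - (((χ (Site.unshift x ν) : ℝ) : ℂ)) • Xf ν u (Site.unshift x ν)) a'
          ≤ P.eps ^ 2 * (a₁ + cχ * a₀) ∧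
      colSumNorm ((((χ x : ℝ) : ℂ)) • Xf ν u x - (((χ (Site.unshift x ν) : ℝ) : ℂ)) • Xf ν u (Site.unshift x ν)) a'
          ≤ P.eps ^ 2 * (a₁ + cχ * a₀) := by
  intro ν u hu x a'
  have hc : ‖((χ x : ℝ) : ℂ)‖ ≤ 1 := norm_ofReal_le_one (hχ x).1 (hχ x).2
  have hd : ‖((χ x - χ (Site.unshift x ν) : ℝ) : ℂ)‖ ≤ P.eps * cχ := by
    rw [Complex.norm_real, Real.norm_eq_abs]; exact hLip ν x
  have hηc : 0 ≤ P.eps * cχ := (abs_nonneg _).trans (hLip ν x)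
  obtain ⟨h0r, h0c⟩ := hw0 ν u hu (Site.unshift x ν) a'
  obtain ⟨h1r, h1c⟩ := hw1 ν u hu x a'
  rw [smul_sub_smul_eq]
  refine ⟨?_, ?_⟩
  · calc rowSumNorm ((((χ x : ℝ) : ℂ)) • (Xf ν u x - Xf ν u (Site.unshift x ν)) +
            ((χ x - χ (Site.unshift x ν) : ℝ) : ℂ) • Xf ν u (Site.unshift x ν)) a'
        ≤ rowSumNorm ((((χ x : ℝ) : ℂ)) • (Xf ν u x - Xf ν u (Site.unshift x ν))) a' +
            rowSumNorm (((χ x - χ (Site.unshift x ν) : ℝ) : ℂ) • Xf ν u (Site.unshift x ν)) a' := rowSumNorm_add_le _ _ a'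
      _ = ‖((χ x : ℝ) : ℂ)‖ * rowSumNorm (Xf ν u x - Xf ν u (Site.unshift x ν)) a' +
            ‖((χ x - χ (Site.unshift x ν) : ℝ) : ℂ)‖ * rowSumNorm (Xf ν u (Site.unshift x ν)) a' := by
          rw [rowSumNorm_smul, rowSumNorm_smul]
      _ ≤ 1 * (P.eps ^ 2 * a₁) + (P.eps * cχ) * (P.eps * a₀) :=
          add_le_add (mul_le_mul hc h1r (rowSumNorm_nonneg _ _) zero_le_one) (mul_le_mul hd h0r (rowSumNorm_nonneg _ _) hηc)
      _ = P.eps ^ 2 * (a₁ + cχ * a₀) := by ring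
  · calc colSumNorm ((((χ x : ℝ) : ℂ)) • (Xf ν u x - Xf ν u (Site.unshift x ν)) +
            ((χ x - χ (Site.unshift x ν) : ℝ) : ℂ) • Xf ν u (Site.unshift x ν)) a'
        ≤ colSumNorm ((((χ x : ℝ) : ℂ)) • (Xf ν u x - Xf ν u (Site.unshift x ν))) a' +
            colSumNorm (((χ x - χ (Site.unshift x ν) : ℝ) : ℂ) • Xf ν u (Site.unshift x ν)) a' := colSumNorm_add_le _ _ a'
      _ = ‖((χ x : ℝ) : ℂ)‖ * colSumNorm (Xf ν u x - Xf ν u (Site.unshift x ν)) a' +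
            ‖((χ x - χ (Site.unshift x ν) : ℝ) : ℂ)‖ * colSumNorm (Xf ν u (Site.unshift x ν)) a' := by
          rw [colSumNorm_smul, colSumNorm_smul]
      _ ≤ 1 * (P.eps ^ 2 * a₁) + (P.eps * cχ) * (P.eps * a₀) :=
          add_le_add (mul_le_mul hc h1c (colSumNorm_nonneg _ _) zero_le_one) (mul_le_mul hd h0c (colSumNorm_nonneg _ _) hηc)
      _ = P.eps ^ 2 * (a₁ + cχ * a₀) := by ring

/-- holomorphy of the entries of `e^{±χ(x)X_ν(u,x)}` from that of the entries of `X_ν(u,x)` (66's END asks for the former).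
[cite: Balaban1985BackgroundPropagators, Cor. 3.5 p.407] -/
theorem truncation_holo (hX : ∀ ν x a' c, DifferentiableOn ℂ (fun u => Xf ν u x a' c) (ball (0 : E) R)) :
    (∀ ν x a' c, DifferentiableOn ℂ (fun u => exp ((((χ x : ℝ) : ℂ)) • Xf ν u x) a' c) (ball (0 : E) R)) ∧
    (∀ ν x a' c, DifferentiableOn ℂ (fun u => exp (-((((χ x : ℝ) : ℂ)) • Xf ν u x)) a' c) (ball (0 : E) R)) := by
  have h : ∀ ν x a' c, DifferentiableOn ℂ (fun u => ((((χ x : ℝ) : ℂ)) • Xf ν u x) a' c) (ball (0 : E) R) := fun ν x a' c => by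
    simp only [Matrix.smul_apply, smul_eq_mul]
    exact (hX ν x a' c).const_mul _
  exact ⟨differentiableOn_exp_entry_family (X := fun ν u x => (((χ x : ℝ) : ℂ)) • Xf ν u x) h,
    differentiableOn_exp_neg_entry_family (X := fun ν u x => (((χ x : ℝ) : ℂ)) • Xf ν u x) h⟩

end Truncation

/-! ## §3. The truncated gauge field's one-scale covariant propagator: 66's END, verbatim, with `a₁ ↦ a₁ + c_χa₀` -/

section Step
variable {d L : ℕ} {a msq : ℝ}
variable {dd N' : ℕ} {E : Type*} [NormedAddCommGroup E] [NormedSpace ℂ E]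

/-- **[B9] COR. 3.5 FOR THE χ-TRUNCATED GAUGE FIELD ON THE WHOLE ONE-SCALE TORUS** (ROAD (c′)).  66's END
`blockWalkExpansion_gaugeField_oneScaleTorus` applied to the bond logarithms `χ(x)·X_ν(u,x)`: for bond logarithms `X` with the two
(3.37)-windows `(a₀, a₁)` on a ball and a cutoff `0 ≤ χ ≤ 1` with `|χ(x) − χ(x − e_ν)| ≤ ηc_χ`, the one-scale covariant propagator
`(Δ_{Ũ}(u) + m² + a_KP_K(Ũ)(u))⁻¹` of `Ũ = e^{χX}` (defects, genuine block averaging along an in-cube contour system `Γ`) is a block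
walk expansion with the relative derivative letters `covB δ₀`, under 66's margin read at `(a₀, a₁ + c_χa₀)` — NO constant depends on
`K`, the volume, the fibre, or the cutoff beyond `c_χ`.  The whole-torus seed `G′(Ũ^□)` of road (c′): NO sub-domain, NO Dirichlet
propagator. [cite: Balaban1985BackgroundPropagators, Cor. 3.5 p.407, (3.35)–(3.37) p.396, p.408, (3.87) p.409; Balaban1984PropagatorsII, Prop. 2.2 (2.67) p.234] -/
theorem blockWalkExpansion_truncatedGaugeField_oneScaleTorus (hd : 1 ≤ d) (hL : Odd L ∧ 1 < L) (ha : 0 < a) (hmsq : 0 ≤ msq) :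
    ∃ δ₀ C : ℝ, 0 < δ₀ ∧ 0 < C ∧ ∀ (i : Index d L) (N : ℕ) (c₀ : B13.Consts) (X : Finset (UT (Nv i.P i.P.K))) (R : ℝ)
      (Xf : Fin i.P.d → E → Site i.P 0 → Matrix (Fin N) (Fin N) ℂ) (χ : Site i.P 0 → ℝ)
      (Γ : Site i.P 0 → List (Fin i.P.d × Site i.P 0)) (Nc : ℕ) (ℓ a₀ a₁ cχ ε μ cμ : ℝ),
      (∀ ν x a' c, DifferentiableOn ℂ (fun u => exp ((((χ x : ℝ) : ℂ)) • Xf ν u x) a' c) (ball (0 : E) R)) →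
      (∀ ν x a' c, DifferentiableOn ℂ (fun u => exp (-((((χ x : ℝ) : ℂ)) • Xf ν u x)) a' c) (ball (0 : E) R)) →
      0 ≤ a₀ → 0 ≤ a₁ → 0 ≤ cχ → (∀ x, 0 ≤ χ x ∧ χ x ≤ 1) → (∀ ν x, |χ x - χ (Site.unshift x ν)| ≤ i.P.eps * cχ) →
      (∀ x, (Γ x).length ≤ Nc) → (Nc : ℝ) * i.P.eps ≤ ℓ → 0 ≤ ℓ →
      (∀ ν, ∀ u ∈ ball (0 : E) R, ∀ x a', rowSumNorm (Xf ν u x) a' ≤ i.P.eps * a₀ ∧ colSumNorm (Xf ν u x) a' ≤ i.P.eps * a₀) →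
      (∀ ν, ∀ u ∈ ball (0 : E) R, ∀ x a', rowSumNorm (Xf ν u x - Xf ν u (Site.unshift x ν)) a' ≤ i.P.eps ^ 2 * a₁ ∧
        colSumNorm (Xf ν u x - Xf ν u (Site.unshift x ν)) a' ≤ i.P.eps ^ 2 * a₁) →
      0 ≤ μ → 2 * μ ≤ ε → 2 * μ ≤ δ₀ / 2 - ε - μ → 0 ≤ cμ →
      RowSum (toB6 (torusGeom (Nv i.P i.P.K) 0 0 0) 0 True) μ cμ →
      cμ * (cμ * 1 * (1 * (((i.P.d : ℝ) * (2 * ((a₁ + cχ * a₀) * Real.exp a₀) + 4 * letterB a₀ ^ 2) +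
        B1RG242Torus.α i.P a i.P.K * (2 * letterG ℓ a₀ + letterG ℓ a₀ ^ 2) +
        ∑ ι, (2 * letterB a₀ + letterB a₀ ^ 2) * covB i.P δ₀ ι) * C)) * cμ) * cμ < 1 →
      ∃ (W : Type) (T : W → (TPt dd N' → ℂ) → E → Matrix (Site i.P 0 × (Fin N × Fin N)) (Site i.P 0 × (Fin N × Fin N)) ℂ)
        (SX' : Set W) (A' : W → ℝ) (D' : W → UT (Nv i.P i.P.K) → UT (Nv i.P i.P.K) → ℝ),
        BlockWalkExpansion c₀ (fun q : Site i.P 0 × (Fin N × Fin N) => cubeOf i.P q.1) (fun q => cubeOf i.P q.1)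
          (fun (_ : TPt dd N' → ℂ) u =>
            (covOp i.P (Fin N × Fin N) (Wp i.P N (fun ν u x => (((χ x : ℝ) : ℂ)) • Xf ν u x))
              (Wm i.P N (fun ν u x => (((χ x : ℝ) : ℂ)) • Xf ν u x))
              (PU i.P (Fin N × Fin N) (Gc i.P N (fun ν u x => (((χ x : ℝ) : ℂ)) • Xf ν u x) Γ)
                (Gci i.P N (fun ν u x => (((χ x : ℝ) : ℂ)) • Xf ν u x) Γ)) a msq u)⁻¹) X R
          (ε - 2 * μ) (δ₀ / 2 - ε - μ - 2 * μ)
          (cμ * C * (1 * (1 - cμ * (cμ * 1 * (1 * (((i.P.d : ℝ) * (2 * ((a₁ + cχ * a₀) * Real.exp a₀) + 4 * letterB a₀ ^ 2) +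
            B1RG242Torus.α i.P a i.P.K * (2 * letterG ℓ a₀ + letterG ℓ a₀ ^ 2) +
            ∑ ι, (2 * letterB a₀ + letterB a₀ ^ 2) * covB i.P δ₀ ι) * C)) * cμ) * cμ)⁻¹) * cμ)
          T SX' A' D' (δ₀ / 2 - 2 * μ) ∧
        (∀ (ι : Fin i.P.d ⊕ Fin i.P.d) ω (σ : TPt dd N' → ℂ), (∀ j, ‖σ j‖ ≤ Real.exp c₀.κ₁) → ∀ u ∈ ball (0 : E) R, ∀ Y Y',
          blockNorm (fun q : Site i.P 0 × (Fin N × Fin N) => cubeOf i.P q.1) (fun q => cubeOf i.P q.1)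
              (covDop i.P (Fin N × Fin N) ι * T ω σ u) Y Y' ≤
            covB i.P δ₀ ι * (A' ω * Real.exp (-((δ₀ / 2 - 2 * μ) * D' ω Y Y')))) ∧
        ∀ ω, DomBy (toB6 (torusGeom (Nv i.P i.P.K) 0 0 0) 0 True) (D' ω) := by
  obtain ⟨δ₀, C, hδ₀, hC, h⟩ := blockWalkExpansion_gaugeField_oneScaleTorus (dd := dd) (N' := N') (E := E) hd hL ha hmsq
  refine ⟨δ₀, C, hδ₀, hC, fun i N c₀ X R Xf χ Γ Nc ℓ a₀ a₁ cχ ε μ cμ hUp hUpi ha₀ ha₁ hcχ hχ hLip hΓ hNc hℓ hw0 hw1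
    hμ hμε hμκ hcμ hrow hq => ?_⟩
  exact h i N c₀ X R (fun ν u x => (((χ x : ℝ) : ℂ)) • Xf ν u x) Γ Nc ℓ a₀ (a₁ + cχ * a₀) ε μ cμ hUp hUpi ha₀ (by positivity)
    hΓ hNc hℓ (truncation_window0 i.P N Xf χ hχ hw0) (truncation_window1 i.P N Xf χ hχ hLip hw0 hw1) hμ hμε hμκ hcμ hrow hq

end Step

end Summit.QuantumFields.BalabanUV.Gaps.D4WalkBlockTruncationWindows

end
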